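import Literature.Analysis.FluidPDE.NSVorticitySlice
import Literature.Analysis.FluidPDE.TaoEnstrophyLocalisationProofs
import Literature.Analysis.FluidPDE.TaoEnstrophyLocalisationParts
import Literature.Analysis.FluidPDE.TaoLocalisation
import HarnessLib

/-!
# The vorticity energy method for classical Navier–Stokes solutions, III: persistence of
# `H^k` regularity — discharge of `NS.tao2011_hasBoundedSobolevNormsOn_of_memSobolevX`

Analysis/FluidPDE file, the last of five files (`CoordDerivatives` → `EnergyToolkit` →
`NSVorticityEnergy` → `NSVorticitySlice` → `NSEnstrophyPersistence`) proving the named fact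
`Literature.Analysis.FluidPDE.tao2011_hasBoundedSobolevNormsOn_of_memSobolevX` of `TaoLocalisation.lean`
(Tao 2011, Cor. 4.3 + Thm. 5.4 (iv) with the closing note of its proof, homogeneous case
`f = 0`, `ν > 0`, classical solutions on the closed slab): *a classical solution of
Navier–Stokes on `[0, T] × ℝ³` lying in `X¹([0, T] × ℝ³) = L^∞_t H¹_x ∩ L²_t H²_x`
(`NS.MemSobolevX 1 T u`) whose datum `u(0)` has all derivatives in `L²` has all Sobolev norms
bounded on `[0, T]` (`NS.HasBoundedSobolevNormsOn (Icc 0 T) u`).*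

Main results:

* `NS.tao2011_hasBoundedSobolevNormsOn_of_memSobolevX_holds` — the discharge;
* `NS.tao2011_hasBoundedSobolevNormsOn_of_enstrophyLocalisation` — consequently the route fact
  `NS.tao2011_hasBoundedSobolevNormsOn` (Tao 2011, Cor. 11.1 + Cor. 4.3 + Thm. 5.4 (iv)) follows
  from the single remaining named fact `NS.tao2011_enstrophyLocalisation_exterior` (Thm. 10.1 in
  exterior form), the other two leaves of its decomposition (`tao2011_sobolev_of_vorticity`,
  `TaoEnstrophyLocalisationProofs`; the present fact) being proved; and
  `NS.tao2011_hasBoundedSobolevNormsOn_of_apriori_leaves` — the same from the three printed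
  leaves of Thm. 10.1 vendored in `TaoEnstrophyLocalisationParts` (Lemma 8.1, Prop. 9.1, §10 a
  priori).

## The proof

Tao's printed proof goes through the mild formulation: pressure normalisation (Lemma 4.1,
Cor. 4.3) and the `H¹` local well-posedness and persistence-of-regularity theory for mild
solutions (Thm. 5.4), none of which is available at this Mathlib pin. For *classical* solutions
(the hypothesis of the fact) the classical physical-space energy method gives the statement
directly, and that is the proof formalised here (Majda–Bertozzi 2002, §3.2, Prop. 3.7: the
`H^m` energy estimate `d/dt ½‖v‖ₘ² + ν‖∇v‖ₘ² ≤ cₘ |∇v|_{L^∞} ‖v‖ₘ²`, here run on the vorticity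
equation and closed with `L²`-based Sobolev inequalities instead of `|∇v|_{L^∞}`):

1. **No pressure, no decay assumptions.** The energy hierarchy is run for the differentiated
   vorticity `∂^βΩ_{ki}`, `Ω_{ki} = ∂ₖuᵢ − ∂ᵢuₖ` (the curl kills `∇p`; `NSVorticityEnergy`), and
   every space integral carries a smooth cutoff `χ_R⁴` (`Fluid.cutoff R`, `= 1` on `B_R`,
   supported in `B_{2R}`, `‖Dχ_R‖ ≤ c/R`), because a classical solution in `X¹` is not known a
   priori to have `∇ⁿΩ(t) ∈ L²`; all bounds are uniform in `R ≥ 1` and the cutoff is removed at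
   the end by monotone convergence.
2. **Slice inequality** (`slice_energy_inequality`, from `NSVorticitySlice`): with
   `X_R(t) = ∫ χ_R⁴ |∇ⁿΩ(t)|²`, `D_R(t) = ∫ χ_R⁴ |∇^{n+1}Ω(t)|²`, `Y_R(t) = ∫ χ_R² |∇^{n+1}u(t)|²`,
   `∂ₜX_R ≤ −ν D_R + C₀ (1 + X_R + Y_R)` whenever `∫ |∇ᵐu(t)|² ≤ S m` for `m ≤ n`
   (`C₀ = C₀(ν, n, S, c, K_GNS)`, independent of `R` and `t`).
3. **Time integration and Grönwall** (`integral_cutoff_vortSq_sub_eq`,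
   `uniform_enstrophy_bounds`): `X_R(t) − X_R(0) = ∫₀ᵗ ∂ₜX_R` by the fundamental theorem of
   calculus on time lines and Fubini (`EnergyToolkit`), `∫₀ᵀ Y_R ≤ I` by the level-`n`
   hypothesis, so `X_R ≤ (X₀ + C₀T + C₀I) e^{C₀T}` and `ν ∫₀ᵀ D_R ≤ M`, uniformly in `R ≥ 1`.
4. **Back to `u` and `R → ∞`** (`sobolev_step`): the weighted div–curl inequality
   `∫ χ⁴|∇^{m+1}u|² ≤ ∫ χ⁴|∇ᵐΩ|² + 48 c²/R² ∫ χ²|∇ᵐu|²` converts the uniform bounds on `∇ⁿΩ`,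
   `∇^{n+1}Ω` into uniform bounds on `∫ χ_R⁴|∇^{n+1}u(t)|²` and `∫₀ᵀ∫ χ_R²|∇^{n+2}u|²`; monotone
   convergence in `R` gives `sup_t ∫ |∇^{n+1}u(t)|² < ∞`, i.e. the level-`(n+1)` hypotheses.
5. **Induction on `n ≥ 1`** (`sobolev_all`) from the base case `MemSobolevX 1` (`sobolev_base`:
   `sup_t ∫|u|², sup_t ∫|∇u|² < ∞` and `∫₀ᵀ∫|∇²u|² < ∞`), the datum supplying `∫ |∇^{n+1}u(0)|² < ∞`
   at each step; finally the coordinate tensors `|∇ᵐu|² = levelSq m u` are compared with the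
   Fréchet derivatives `‖Dᵐu‖²` of `HasBoundedSobolevNormsOn` (constants `3^{m+1}`, section
   `Comparison`).

No new definitions and no notation (`ℝ³` abbreviates `EuclideanSpace ℝ (Fin 3)` in this text only).

## References

* T. Tao, *Localisation and compactness properties of the Navier–Stokes global regularity
  problem*, Anal. PDE 6 (2013), 25–107; arXiv:1108.1165 (`Tao2011`): Cor. 4.3 (held arXiv
  copy: Corollary 27, p. 15), Thm. 5.4 (iv) and the note closing its proof (held copy:
  Theorem 31, p. 18), Cor. 11.1 (held copy: Corollary 68, p. 36).
* A. J. Majda, A. L. Bertozzi, *Vorticity and Incompressible Flow*, CUP (2002)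
  (`MajdaBertozzi2002`), §1.4, vorticity equation (1.32)–(1.33) (held copy p. 19); §3.1,
  Lemma 3.1 (Grönwall; held copy p. 78); §3.2, Prop. 3.7, eq. (3.58) (the `H^m` energy
  estimate; held copy p. 93). [folklore]
* C. R. Doering, J. D. Gibbon, *Applied Analysis of the Navier–Stokes Equations*, CUP (1995)
  (`DoeringGibbon1995`), §6.1 (6.1.2), (6.1.5)–(6.1.6) (held copy p. 96); §6.2, Thm. 6.1 (the
  ladder of `H_N` inequalities; held copy p. 99). [folklore]
-/

noncomputable section

open MeasureTheory Set Function Filter Topology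
open scoped ENNReal NNReal ContDiff BigOperators

namespace Literature.Analysis.FluidPDE


/-! ## Comparison of the coordinate tensors with the Fréchet derivatives -/

section Comparison

variable {v : EuclideanSpace ℝ (Fin 3) → EuclideanSpace ℝ (Fin 3)}

/-- `|∇ᵐ v (x)|² ≤ 3^{m+1} ‖Dᵐ v (x)‖²`. [folklore] -/
theorem levelSq_le_pow_mul_sq_norm_iteratedFDeriv (hv : ContDiff ℝ ∞ v) (m : ℕ) (x : EuclideanSpace ℝ (Fin 3)) :
    levelSq m v x ≤ 3 ^ (m + 1) * ‖iteratedFDeriv ℝ m v x‖ ^ 2 := by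
  have hV : ∀ i, ContDiff ℝ ∞ fun y => v y i := fun i => contDiff_comp_of_contDiff hv i
  unfold levelSq
  calc ∑ i, dnormSq m (fun y => v y i) x
      ≤ ∑ _i : Fin 3, (3 : ℝ) ^ m * ‖iteratedFDeriv ℝ m v x‖ ^ 2 :=
        Finset.sum_le_sum fun i _ => by
          refine (dnormSq_le_card_pow_mul_sq_norm_iteratedFDeriv (hV i) m x).trans ?_
          rw [Fintype.card_fin]
          push_cast
          exact mul_le_mul_of_nonneg_left (pow_le_pow_left₀ (norm_nonneg _)
            (norm_iteratedFDeriv_apply_le hv i m x) 2) (by positivity)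
    _ = 3 ^ (m + 1) * ‖iteratedFDeriv ℝ m v x‖ ^ 2 := by
        rw [Finset.sum_const, Finset.card_univ, Fintype.card_fin, nsmul_eq_mul, pow_succ]
        push_cast
        ring

/-- `‖Dᵐ v (x)‖² ≤ 3^{m+1} |∇ᵐ v (x)|²`. [folklore] -/
theorem sq_norm_iteratedFDeriv_le_pow_mul_levelSq (hv : ContDiff ℝ ∞ v) (m : ℕ) (x : EuclideanSpace ℝ (Fin 3)) :
    ‖iteratedFDeriv ℝ m v x‖ ^ 2 ≤ 3 ^ (m + 1) * levelSq m v x := by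
  have hV : ∀ i, ContDiff ℝ ∞ fun y => v y i := fun i => contDiff_comp_of_contDiff hv i
  have h1 := norm_iteratedFDeriv_le_sum_norm_iteratedFDeriv_apply hv m x
  have h2 : (∑ i, ‖iteratedFDeriv ℝ m (fun y => v y i) x‖) ^ 2 ≤
      (Finset.univ : Finset (Fin 3)).card * ∑ i, ‖iteratedFDeriv ℝ m (fun y => v y i) x‖ ^ 2 :=
    sq_sum_le_card_mul_sum_sq
  rw [Finset.card_univ, Fintype.card_fin] at h2
  push_cast at h2
  have h3 : ∀ i, ‖iteratedFDeriv ℝ m (fun y => v y i) x‖ ^ 2 ≤ 3 ^ m * dnormSq m (fun y => v y i) x :=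
    fun i => by
      have := sq_norm_iteratedFDeriv_le_card_pow_mul_dnormSq (hV i) m x
      rw [Fintype.card_fin] at this
      push_cast at this
      exact this
  calc ‖iteratedFDeriv ℝ m v x‖ ^ 2 ≤ (∑ i, ‖iteratedFDeriv ℝ m (fun y => v y i) x‖) ^ 2 :=
        pow_le_pow_left₀ (norm_nonneg _) h1 2
    _ ≤ 3 * ∑ i, ‖iteratedFDeriv ℝ m (fun y => v y i) x‖ ^ 2 := h2
    _ ≤ 3 * ∑ i, 3 ^ m * dnormSq m (fun y => v y i) x :=
        mul_le_mul_of_nonneg_left (Finset.sum_le_sum fun i _ => h3 i) (by norm_num)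
    _ = 3 ^ (m + 1) * levelSq m v x := by
        rw [← Finset.mul_sum, levelSq, pow_succ]
        ring

/-- If `∫ ‖Dᵐ v‖² < ∞` (lower Lebesgue integral) then `|∇ᵐ v|²` is integrable with
`∫ |∇ᵐ v|² ≤ 3^{m+1} (∫⁻ ‖Dᵐ v‖ₑ²).toReal`. [folklore] -/
theorem integrable_levelSq_of_lintegral_lt_top (hv : ContDiff ℝ ∞ v) (m : ℕ)
    (h : ∫⁻ x, ‖iteratedFDeriv ℝ m v x‖ₑ ^ 2 < ⊤) :
    Integrable (levelSq m v) ∧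
      ∫ x, levelSq m v x ≤ 3 ^ (m + 1) * (∫⁻ x, ‖iteratedFDeriv ℝ m v x‖ₑ ^ 2).toReal := by
  have hint : Integrable fun x => ‖iteratedFDeriv ℝ m v x‖ ^ 2 :=
    integrable_sq_norm_of_lintegral_lt_top
      (hv.continuous_iteratedFDeriv (by exact_mod_cast le_top)) h
  have hdom : Integrable fun x => 3 ^ (m + 1) * ‖iteratedFDeriv ℝ m v x‖ ^ 2 := hint.const_mul _
  have hL : Integrable (levelSq m v) := by
    refine hdom.mono' (continuous_levelSq hv m).aestronglyMeasurable (Eventually.of_forall fun x => ?_)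
    rw [Real.norm_of_nonneg (levelSq_nonneg m v x)]
    exact levelSq_le_pow_mul_sq_norm_iteratedFDeriv hv m x
  refine ⟨hL, ?_⟩
  calc ∫ x, levelSq m v x ≤ ∫ x, 3 ^ (m + 1) * ‖iteratedFDeriv ℝ m v x‖ ^ 2 :=
        integral_mono hL hdom fun x => levelSq_le_pow_mul_sq_norm_iteratedFDeriv hv m x
    _ = 3 ^ (m + 1) * (∫⁻ x, ‖iteratedFDeriv ℝ m v x‖ₑ ^ 2).toReal := by
        rw [integral_const_mul, ← ofReal_integral_sq_norm hint, ENNReal.toReal_ofReal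
          (integral_nonneg fun _ => sq_nonneg _)]

/-- Conversely, `∫⁻ ‖Dᵐ v‖ₑ² ≤ ofReal (3^{m+1} ∫ |∇ᵐ v|²)` when `|∇ᵐ v|²` is integrable. [folklore] -/
theorem lintegral_sq_norm_iteratedFDeriv_le (hv : ContDiff ℝ ∞ v) (m : ℕ)
    (h : Integrable (levelSq m v)) :
    ∫⁻ x, ‖iteratedFDeriv ℝ m v x‖ₑ ^ 2 ≤ ENNReal.ofReal (3 ^ (m + 1) * ∫ x, levelSq m v x) := by
  rw [lintegral_enorm_sq_eq_lintegral_ofReal, ← integral_const_mul,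
    ofReal_integral_eq_lintegral_ofReal (h.const_mul _) (ae_of_all _ fun x =>
      mul_nonneg (by positivity) (levelSq_nonneg m v x))]
  exact lintegral_mono fun x => ENNReal.ofReal_le_ofReal
    (sq_norm_iteratedFDeriv_le_pow_mul_levelSq hv m x)

end Comparison

/-! ## Classical solutions: joint continuity of the coordinate tensors, the slice inequality -/

section Solution

variable {T ν : ℝ} {u : ℝ → EuclideanSpace ℝ (Fin 3) → EuclideanSpace ℝ (Fin 3)} {p : ℝ → EuclideanSpace ℝ (Fin 3) → ℝ}

/-- `[0, T]` lies in the closure of its interior (`T > 0`). [folklore] -/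
theorem Icc_subset_closure_interior (hT : 0 < T) : Icc 0 T ⊆ closure (interior (Icc (0 : ℝ) T)) := by
  rw [interior_Icc, closure_Ioo hT.ne]

/-- The fields `(t, x) ↦ ∂^γ uᵢ (t, x)` are jointly smooth on `[0, T] × ℝ³`. [folklore] -/
theorem IsClassicalNSSolutionOn.isSmoothSpaceTimeOn_levelFam
    (h : IsClassicalNSSolutionOn (Icc 0 T) ν 0 u p) (hT : 0 < T) (m : ℕ)
    (c : (Fin m → Fin 3) × Fin 3) :
    IsSmoothSpaceTimeOn (Icc 0 T) fun t x => levelFam m (u t) c x :=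
  (h.isSmoothSpaceTimeOn_comp c.2).ipderiv_slice (uniqueDiffOn_Icc hT) c.1

/-- The fields `(t, x) ↦ ∂^β Ω_{ki} (t, x)` are jointly smooth on `[0, T] × ℝ³`. [folklore] -/
theorem IsClassicalNSSolutionOn.isSmoothSpaceTimeOn_vortFam
    (h : IsClassicalNSSolutionOn (Icc 0 T) ν 0 u p) (hT : 0 < T) (n : ℕ)
    (c : (Fin n → Fin 3) × Fin 3 × Fin 3) :
    IsSmoothSpaceTimeOn (Icc 0 T) fun t x => vortFam n (u t) c x := by
  have hU := uniqueDiffOn_Icc hT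
  have h1 : IsSmoothSpaceTimeOn (Icc 0 T) fun t x => vortComp (u t) c.2.1 c.2.2 x :=
    ((h.isSmoothSpaceTimeOn_comp c.2.2).pderiv_slice hU c.2.1).sub
      ((h.isSmoothSpaceTimeOn_comp c.2.1).pderiv_slice hU c.2.2)
  exact h1.ipderiv_slice hU c.1

/-- Joint continuity of `(t, x) ↦ |∇ᵐ u (t, x)|²` on `[0, T] × ℝ³`. [folklore] -/
theorem IsClassicalNSSolutionOn.continuousOn_levelSq
    (h : IsClassicalNSSolutionOn (Icc 0 T) ν 0 u p) (hT : 0 < T) (m : ℕ) :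
    ContinuousOn (fun z : ℝ × (EuclideanSpace ℝ (Fin 3)) => levelSq m (u z.1) z.2) (Icc 0 T ×ˢ univ) := by
  have e : (fun z : ℝ × (EuclideanSpace ℝ (Fin 3)) => levelSq m (u z.1) z.2) =
      fun z => ∑ c : (Fin m → Fin 3) × Fin 3, (levelFam m (u z.1) c z.2) ^ 2 := by
    funext z
    rw [sum_sq_levelFam]
  rw [e]
  exact continuousOn_finsetSum _ fun c _ =>
    ((h.isSmoothSpaceTimeOn_levelFam hT m c).continuousOn).pow 2

/-- Joint continuity of `(t, x) ↦ |∇ⁿ Ω (t, x)|²` on `[0, T] × ℝ³`. [folklore] -/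
theorem IsClassicalNSSolutionOn.continuousOn_vortSq
    (h : IsClassicalNSSolutionOn (Icc 0 T) ν 0 u p) (hT : 0 < T) (n : ℕ) :
    ContinuousOn (fun z : ℝ × (EuclideanSpace ℝ (Fin 3)) => vortSq n (u z.1) z.2) (Icc 0 T ×ˢ univ) := by
  have e : (fun z : ℝ × (EuclideanSpace ℝ (Fin 3)) => vortSq n (u z.1) z.2) =
      fun z => ∑ c : (Fin n → Fin 3) × Fin 3 × Fin 3, (vortFam n (u z.1) c z.2) ^ 2 := by
    funext z
    rw [sum_sq_vortFam]
  rw [e]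
  exact continuousOn_finsetSum _ fun c _ =>
    ((h.isSmoothSpaceTimeOn_vortFam hT n c).continuousOn).pow 2

/-- Continuity in time of the localised integrals `t ↦ ∫ χʲ |∇ᵐ u(t)|²`. [folklore] -/
theorem IsClassicalNSSolutionOn.continuousOn_integral_cutoff_pow_mul_levelSq
    (h : IsClassicalNSSolutionOn (Icc 0 T) ν 0 u p) (hT : 0 < T) {R : ℝ} (hR : 0 < R)
    (j m : ℕ) (hj : j ≠ 0) :
    ContinuousOn (fun t => ∫ x, cutoff R x ^ j * levelSq m (u t) x) (Icc 0 T) :=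
  continuousOn_integral_mul_of_continuousOn
    (((contDiff_cutoff (n := 0) R).continuous.pow j) : Continuous fun x : (EuclideanSpace ℝ (Fin 3)) => cutoff R x ^ j)
    (hasCompactSupport_pow (hasCompactSupport_cutoff (E := (EuclideanSpace ℝ (Fin 3))) hR) hj) (h.continuousOn_levelSq hT m)

/-- Continuity in time of the localised integrals `t ↦ ∫ χʲ |∇ⁿ Ω(t)|²`. [folklore] -/
theorem IsClassicalNSSolutionOn.continuousOn_integral_cutoff_pow_mul_vortSq
    (h : IsClassicalNSSolutionOn (Icc 0 T) ν 0 u p) (hT : 0 < T) {R : ℝ} (hR : 0 < R)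
    (j n : ℕ) (hj : j ≠ 0) :
    ContinuousOn (fun t => ∫ x, cutoff R x ^ j * vortSq n (u t) x) (Icc 0 T) :=
  continuousOn_integral_mul_of_continuousOn
    (((contDiff_cutoff (n := 0) R).continuous.pow j) : Continuous fun x : (EuclideanSpace ℝ (Fin 3)) => cutoff R x ^ j)
    (hasCompactSupport_pow (hasCompactSupport_cutoff (E := (EuclideanSpace ℝ (Fin 3))) hR) hj) (h.continuousOn_vortSq hT n)

/-- Continuity in time of the pairings `t ↦ ∫ χ⁴ ∂ₜW_c W_c`. [folklore] -/
theorem IsClassicalNSSolutionOn.continuousOn_integral_cutoff_pow_mul_timeDerivWithin_mul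
    (h : IsClassicalNSSolutionOn (Icc 0 T) ν 0 u p) (hT : 0 < T) {R : ℝ} (hR : 0 < R)
    (n : ℕ) (c : (Fin n → Fin 3) × Fin 3 × Fin 3) :
    ContinuousOn (fun t => ∫ x, cutoff R x ^ 4 *
      (FluidPDE.timeDerivWithin (Icc 0 T) (fun s y => vortFam n (u s) c y) t x * vortFam n (u t) c x))
      (Icc 0 T) := by
  have hW := h.isSmoothSpaceTimeOn_vortFam hT n c
  have hWt := hW.timeDerivWithin (uniqueDiffOn_Icc hT)
  exact continuousOn_integral_mul_of_continuousOn ((contDiff_cutoff (n := 0) R).continuous.pow 4)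
    (hasCompactSupport_pow (hasCompactSupport_cutoff hR) (by norm_num))
    (hWt.continuousOn.mul hW.continuousOn)

/-- The companion cutoff: `χ_{2R} = 1` wherever `χ_R ≠ 0` (`R > 0`). [folklore] -/
theorem cutoff_two_mul_eq_one_of_ne {R : ℝ} (hR : 0 < R) {x : EuclideanSpace ℝ (Fin 3)} (hx : cutoff R x ≠ 0) :
    cutoff (2 * R) x = 1 := by
  refine cutoff_eq_one (by linarith) ?_
  by_contra hlt
  exact hx (cutoff_eq_zero hR (not_le.1 hlt).le)

/-- `χ_R² ≤ χ_{2R}⁴` pointwise (`R > 0`). [folklore] -/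
theorem cutoff_sq_le_cutoff_two_mul_pow_four {R : ℝ} (hR : 0 < R) (x : EuclideanSpace ℝ (Fin 3)) :
    cutoff R x ^ 2 ≤ cutoff (2 * R) x ^ 4 := by
  by_cases hx : cutoff R x = 0
  · rw [hx]; simpa using pow_nonneg (cutoff_nonneg (2 * R) x) 4
  · rw [cutoff_two_mul_eq_one_of_ne hR hx, one_pow]
    exact pow_le_one₀ (cutoff_nonneg R x) (cutoff_le_one R x)

/-- **The slice energy inequality for classical solutions.** For an unforced classical solution
on `[0, T] × ℝ³` (`ν > 0`), `n ≥ 1` and nonnegative constants `S m`, there is `C₀` such that for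
all `R ≥ 1` and all `t ∈ [0, T]` at which `∫ |∇ᵐu(t)|² ≤ S m` for `m ≤ n`:
`∑ 2 ∫ χ_R⁴ ∂ₜ(∂^βΩ_{ki}) ∂^βΩ_{ki} ≤ −ν ∫ χ_R⁴ |∇^{n+1}Ω|² + C₀ (1 + ∫ χ_R⁴ |∇ⁿΩ|² + ∫ χ_R² |∇^{n+1}u|²)`
(the core inequality with `v = u(t)`, `Ẇ = ∂ₜ∂^βΩ_{ki}` bounded by the differentiated vorticity
equation `abs_vorticity_forcing_le`, `φ = χ_R`, `φ' = χ_{2R}`). [folklore] -/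
theorem IsClassicalNSSolutionOn.slice_energy_inequality
    (h : IsClassicalNSSolutionOn (Icc 0 T) ν 0 u p) (hν : 0 < ν) (hT : 0 < T) {n : ℕ}
    (hn : 1 ≤ n) (S : ℕ → ℝ) (hS : ∀ m, 0 ≤ S m) :
    ∃ C₀ : ℝ, 0 ≤ C₀ ∧ ∀ R : ℝ, 1 ≤ R → ∀ t ∈ Icc 0 T,
      (∀ m ≤ n, Integrable (levelSq m (u t))) → (∀ m ≤ n, ∫ x, levelSq m (u t) x ≤ S m) →
      ∑ c', 2 * ∫ x, cutoff R x ^ 4 *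
          (FluidPDE.timeDerivWithin (Icc 0 T) (fun s y => vortFam n (u s) c' y) t x *
            vortFam n (u t) c' x) ≤
        -ν * (∫ x, cutoff R x ^ 4 * vortSq (n + 1) (u t) x) +
          C₀ * (1 + (∫ x, cutoff R x ^ 4 * vortSq n (u t) x) +
            ∫ x, cutoff R x ^ 2 * levelSq (n + 1) (u t) x) := by
  obtain ⟨c, hc0, hc⟩ := exists_norm_fderiv_cutoff_le (E := (EuclideanSpace ℝ (Fin 3)))
  have hCF : (0 : ℝ) ≤ 2 * 3 * 2 ^ (n + 1) := by positivity
  obtain ⟨C₀, hC₀0, hC₀⟩ := slice_energy_inequality_core hν hc0 hCF hn S hS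
  refine ⟨C₀, hC₀0, fun R hR t ht hint hSv => ?_⟩
  have hR0 : 0 < R := by linarith
  have hU := uniqueDiffOn_Icc hT
  have hcl := Icc_subset_closure_interior hT
  have hv : ContDiff ℝ ∞ (u t) := h.contDiff_velocity ht
  have hdiv : ∀ x, ∑ i, pderiv i (fun y => u t y i) x = 0 := fun x => h.sum_pderiv_comp_eq_zero ht x
  -- the cutoffs
  have hgrad : ∀ {R'}, 1 ≤ R' → ∀ x, ‖fderiv ℝ (cutoff R') x‖ ≤ c := fun {R'} hR' x =>
    (hc R' (by linarith) x).trans (div_le_self hc0 hR')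
  -- the time derivatives
  have hWc : ∀ c', Continuous fun x =>
      FluidPDE.timeDerivWithin (Icc 0 T) (fun s y => vortFam n (u s) c' y) t x := fun c' =>
    (((h.isSmoothSpaceTimeOn_vortFam hT n c').timeDerivWithin hU).contDiff_slice ht).continuous
  have hforce : ∀ c' x, |FluidPDE.timeDerivWithin (Icc 0 T) (fun s y => vortFam n (u s) c' y) t x -
        ν * ∑ j, pderiv j (pderiv j (vortFam n (u t) c')) x +
        ∑ j, u t x j * pderiv j (vortFam n (u t) c') x| ≤
      2 * 3 * 2 ^ (n + 1) * ∑ a ∈ Finset.Icc 1 (n + 1),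
        Real.sqrt (levelSq a (u t) x) * Real.sqrt (levelSq (n + 2 - a) (u t) x) := by
    intro c' x
    have := h.abs_vorticity_forcing_le hU hcl ht x c'.1 c'.2.1 c'.2.2
    rw [Fintype.card_fin] at this
    push_cast at this
    exact this
  exact hC₀ (u t) (cutoff R) (cutoff (2 * R)) _ hv hdiv (contDiff_cutoff R)
    (hasCompactSupport_cutoff hR0) (cutoff_nonneg R) (cutoff_le_one R) (hgrad hR)
    (contDiff_cutoff (2 * R)) (hasCompactSupport_cutoff (by linarith)) (cutoff_nonneg (2 * R))
    (cutoff_le_one (2 * R)) (hgrad (by linarith)) (fun x hx => cutoff_two_mul_eq_one_of_ne hR0 hx)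
    hWc hforce hint hSv

/-- `∑_c ∫ χʲ (∂^βΩ_{ki})² = ∫ χʲ |∇ⁿΩ|²`. [folklore] -/
theorem sum_integral_cutoff_pow_mul_vortFam_sq {v : EuclideanSpace ℝ (Fin 3) → EuclideanSpace ℝ (Fin 3)} (hv : ContDiff ℝ ∞ v) {R : ℝ}
    (hR : 0 < R) (n : ℕ) {j : ℕ} (hj : j ≠ 0) :
    ∑ c', ∫ x, cutoff R x ^ j * vortFam n v c' x ^ 2 = ∫ x, cutoff R x ^ j * vortSq n v x := by
  have h1 : Continuous (cutoff (E := (EuclideanSpace ℝ (Fin 3))) R) := (contDiff_cutoff (n := 0) R).continuous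
  have h2 : HasCompactSupport (cutoff (E := (EuclideanSpace ℝ (Fin 3))) R) := hasCompactSupport_cutoff hR
  have hi : ∀ c', Integrable fun x => cutoff R x ^ j * vortFam n v c' x ^ 2 := fun c' => by
    have h3 : Continuous fun x => vortFam n v c' x ^ 2 := (contDiff_vortFam hv n c').continuous.pow 2
    exact integrable_pow_mul_of_continuous h1 h2 h3 hj
  rw [← integral_finsetSum _ fun c' _ => hi c']
  refine integral_congr_ae (Eventually.of_forall fun x => ?_)
  simp only
  rw [← Finset.mul_sum, sum_sq_vortFam]

/-- A function continuous on `[0, T]` is integrable on `(0, t)` for `t ∈ [0, T]`. [folklore] -/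
theorem integrableOn_Ioo_of_continuousOn {f : ℝ → ℝ} (hf : ContinuousOn f (Icc 0 T)) {t : ℝ}
    (ht : t ∈ Icc 0 T) : IntegrableOn f (Ioo 0 t) :=
  ((hf.mono (Icc_subset_Icc le_rfl ht.2)).integrableOn_compact isCompact_Icc).mono_set
    Ioo_subset_Icc_self

/-- **The localised enstrophy identity in time**: for `t ∈ [0, T]`,
`∫ χ_R⁴ |∇ⁿΩ(t)|² − ∫ χ_R⁴ |∇ⁿΩ(0)|² = ∫₀ᵗ ∑ 2 ∫ χ_R⁴ ∂ₜ(∂^βΩ_{ki}) ∂^βΩ_{ki}`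
(the fundamental theorem of calculus on time lines and Fubini, component by component).
[folklore] -/
theorem IsClassicalNSSolutionOn.integral_cutoff_vortSq_sub_eq
    (h : IsClassicalNSSolutionOn (Icc 0 T) ν 0 u p) (hT : 0 < T) {R : ℝ} (hR : 0 < R) (n : ℕ)
    {t : ℝ} (ht : t ∈ Icc 0 T) :
    (∫ x, cutoff R x ^ 4 * vortSq n (u t) x) - ∫ x, cutoff R x ^ 4 * vortSq n (u 0) x =
      ∫ τ in Ioo 0 t, ∑ c', 2 * ∫ x, cutoff R x ^ 4 *
        (FluidPDE.timeDerivWithin (Icc 0 T) (fun s y => vortFam n (u s) c' y) τ x *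
          vortFam n (u τ) c' x) := by
  have hφc : Continuous fun x : (EuclideanSpace ℝ (Fin 3)) => cutoff R x ^ 4 := (contDiff_cutoff (n := 0) R).continuous.pow 4
  have hφs : HasCompactSupport fun x : (EuclideanSpace ℝ (Fin 3)) => cutoff R x ^ 4 :=
    hasCompactSupport_pow (hasCompactSupport_cutoff hR) (by norm_num)
  have hE2 : ∀ c', ∫ τ in Ioo 0 t, ∫ x, cutoff R x ^ 4 *
      (FluidPDE.timeDerivWithin (Icc 0 T) (fun s y => vortFam n (u s) c' y) τ x * vortFam n (u τ) c' x) =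
      2⁻¹ * (∫ x, cutoff R x ^ 4 * vortFam n (u t) c' x ^ 2) -
        2⁻¹ * (∫ x, cutoff R x ^ 4 * vortFam n (u 0) c' x ^ 2) := fun c' =>
    (h.isSmoothSpaceTimeOn_vortFam hT n c').integral_Ioo_integral_mul_timeDerivWithin_mul hT hφc
      hφs le_rfl ht.1 ht.2
  have hIo : ∀ c', IntegrableOn (fun τ => ∫ x, cutoff R x ^ 4 *
      (FluidPDE.timeDerivWithin (Icc 0 T) (fun s y => vortFam n (u s) c' y) τ x * vortFam n (u τ) c' x))
      (Ioo 0 t) := fun c' =>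
    integrableOn_Ioo_of_continuousOn
      (h.continuousOn_integral_cutoff_pow_mul_timeDerivWithin_mul hT hR n c') ht
  rw [integral_finsetSum _ fun c' _ => (hIo c').const_mul 2]
  simp only [integral_const_mul, hE2]
  rw [← sum_integral_cutoff_pow_mul_vortFam_sq (h.contDiff_velocity ht) hR n (j := 4) (by norm_num),
    ← sum_integral_cutoff_pow_mul_vortFam_sq (h.contDiff_velocity ⟨le_rfl, hT.le⟩) hR n (j := 4)
      (by norm_num), ← Finset.sum_sub_distrib]
  exact Finset.sum_congr rfl fun c' _ => by ring

/-- **Uniform localised bounds (Grönwall).** For an unforced classical solution on `[0, T] × ℝ³`,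
`ν > 0`, `n ≥ 1`: if `∫ |∇ᵐu(t)|² ≤ S m` for `m ≤ n`, `t ∈ [0, T]`, the localised `L²_t`-norms
`∫₀ᵀ ∫ χ_R² |∇^{n+1}u|²` are bounded by `I` uniformly in `R ≥ 1`, and `∫ χ_R⁴ |∇ⁿΩ(0)|² ≤ X₀`, then
`∫ χ_R⁴ |∇ⁿΩ(t)|²` and `∫₀ᵀ ∫ χ_R⁴ |∇^{n+1}Ω|²` are bounded uniformly in `R ≥ 1`, `t ∈ [0, T]`
(integrate the slice inequality in time and apply Grönwall's inequality). [folklore] -/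
theorem IsClassicalNSSolutionOn.uniform_enstrophy_bounds
    (h : IsClassicalNSSolutionOn (Icc 0 T) ν 0 u p) (hν : 0 < ν) (hT : 0 < T) {n : ℕ}
    (hn : 1 ≤ n) (S : ℕ → ℝ) (hS : ∀ m, 0 ≤ S m)
    (hPS : ∀ m ≤ n, ∀ t ∈ Icc 0 T, Integrable (levelSq m (u t)) ∧ ∫ x, levelSq m (u t) x ≤ S m)
    {I : ℝ} (hPI : ∀ R, 1 ≤ R → ∫ τ in Ioo 0 T, ∫ x, cutoff R x ^ 2 * levelSq (n + 1) (u τ) x ≤ I)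
    {X₀ : ℝ} (hX₀ : ∀ R, 1 ≤ R → ∫ x, cutoff R x ^ 4 * vortSq n (u 0) x ≤ X₀) :
    ∃ M : ℝ, ∀ R, 1 ≤ R →
      (∀ t ∈ Icc 0 T, ∫ x, cutoff R x ^ 4 * vortSq n (u t) x ≤ M) ∧
        ∫ τ in Ioo 0 T, ∫ x, cutoff R x ^ 4 * vortSq (n + 1) (u τ) x ≤ M := by
  obtain ⟨C₀, hC₀0, hC₀⟩ := h.slice_energy_inequality hν hT hn S hS
  -- `I ≥ 0` and `X₀ ≥ 0`
  have hI0 : 0 ≤ I := (setIntegral_nonneg measurableSet_Ioo fun τ _ =>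
    integral_nonneg fun x => mul_nonneg (sq_nonneg _) (levelSq_nonneg _ _ _)).trans (hPI 1 le_rfl)
  have hX₀0 : 0 ≤ X₀ := (integral_nonneg fun x =>
    mul_nonneg (pow_nonneg (cutoff_nonneg _ _) 4) (vortSq_nonneg _ _ _)).trans (hX₀ 1 le_rfl)
  set A : ℝ := X₀ + C₀ * T + C₀ * I with hA
  have hA0 : 0 ≤ A := by positivity
  set M₁ : ℝ := A * Real.exp (C₀ * T) with hM₁
  have hM₁0 : 0 ≤ M₁ := by positivity
  refine ⟨max M₁ ((A + C₀ * (T * M₁)) / ν), fun R hR => ?_⟩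
  have hR0 : 0 < R := by linarith
  have h0T : (0 : ℝ) ∈ Icc 0 T := ⟨le_rfl, hT.le⟩
  -- the four functions of time (opaque, with defining equations)
  obtain ⟨X, hX⟩ : ∃ X : ℝ → ℝ, X = fun t => ∫ x, cutoff R x ^ 4 * vortSq n (u t) x := ⟨_, rfl⟩
  obtain ⟨D, hD⟩ : ∃ D : ℝ → ℝ, D = fun t => ∫ x, cutoff R x ^ 4 * vortSq (n + 1) (u t) x := ⟨_, rfl⟩
  obtain ⟨Y, hY⟩ : ∃ Y : ℝ → ℝ, Y = fun t => ∫ x, cutoff R x ^ 2 * levelSq (n + 1) (u t) x := ⟨_, rfl⟩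
  obtain ⟨Φ, hΦ⟩ : ∃ Φ : ℝ → ℝ, Φ = fun t => ∑ c', 2 * ∫ x, cutoff R x ^ 4 *
      (FluidPDE.timeDerivWithin (Icc 0 T) (fun s y => vortFam n (u s) c' y) t x *
        vortFam n (u t) c' x) := ⟨_, rfl⟩
  have cX : ContinuousOn X (Icc 0 T) := by
    rw [hX]; exact h.continuousOn_integral_cutoff_pow_mul_vortSq hT hR0 4 n (by norm_num)
  have cD : ContinuousOn D (Icc 0 T) := by
    rw [hD]; exact h.continuousOn_integral_cutoff_pow_mul_vortSq hT hR0 4 (n + 1) (by norm_num)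
  have cY : ContinuousOn Y (Icc 0 T) := by
    rw [hY]; exact h.continuousOn_integral_cutoff_pow_mul_levelSq hT hR0 2 (n + 1) (by norm_num)
  have cΦ : ContinuousOn Φ (Icc 0 T) := by
    rw [hΦ]
    exact continuousOn_finsetSum _ fun c' _ =>
      (h.continuousOn_integral_cutoff_pow_mul_timeDerivWithin_mul hT hR0 n c').const_smul (2 : ℝ)
        |>.congr fun t _ => by simp [smul_eq_mul]
  have hX0' : ∀ t, 0 ≤ X t := fun t => by
    rw [hX]; exact integral_nonneg fun x =>
      mul_nonneg (pow_nonneg (cutoff_nonneg _ _) 4) (vortSq_nonneg _ _ _)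
  have hD0' : ∀ t, 0 ≤ D t := fun t => by
    rw [hD]; exact integral_nonneg fun x =>
      mul_nonneg (pow_nonneg (cutoff_nonneg _ _) 4) (vortSq_nonneg _ _ _)
  have hY0' : ∀ t, 0 ≤ Y t := fun t => by
    rw [hY]; exact integral_nonneg fun x => mul_nonneg (sq_nonneg _) (levelSq_nonneg _ _ _)
  -- the slice inequality and the time identity
  have hSEI : ∀ τ ∈ Icc 0 T, Φ τ ≤ -ν * D τ + C₀ * (1 + X τ + Y τ) := fun τ hτ => by
    rw [hΦ, hD, hX, hY]
    exact hC₀ R hR τ hτ (fun m hm => (hPS m hm τ hτ).1) (fun m hm => (hPS m hm τ hτ).2)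
  have hFTC : ∀ t ∈ Icc 0 T, X t - X 0 = ∫ τ in Ioo 0 t, Φ τ := fun t ht => by
    rw [hX, hΦ]; exact h.integral_cutoff_vortSq_sub_eq hT hR0 n ht
  -- integrate the slice inequality
  have hY_le : ∀ t ∈ Icc 0 T, ∫ τ in Ioo 0 t, Y τ ≤ I := fun t ht => by
    refine le_trans (setIntegral_mono_set (integrableOn_Ioo_of_continuousOn cY ⟨hT.le, le_rfl⟩)
      (ae_of_all _ fun τ => hY0' τ) (ae_of_all _ (Ioo_subset_Ioo le_rfl ht.2))) ?_
    rw [hY]; exact hPI R hR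
  have hmain : ∀ t ∈ Icc 0 T, X t + ν * ∫ τ in Ioo 0 t, D τ ≤ A + C₀ * ∫ τ in Ioo 0 t, X τ := by
    intro t ht
    have iΦ := integrableOn_Ioo_of_continuousOn cΦ ht
    have iX := integrableOn_Ioo_of_continuousOn cX ht
    have iD := integrableOn_Ioo_of_continuousOn cD ht
    have iY := integrableOn_Ioo_of_continuousOn cY ht
    have i1 : IntegrableOn (fun _ => (1 : ℝ)) (Ioo 0 t) :=
      integrableOn_const (by rw [Real.volume_Ioo]; exact ENNReal.ofReal_ne_top)
    have i1X : IntegrableOn (fun τ => 1 + X τ) (Ioo 0 t) := i1.add iX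
    have iXY : IntegrableOn (fun τ => 1 + X τ + Y τ) (Ioo 0 t) := i1X.add iY
    have iC : IntegrableOn (fun τ => C₀ * (1 + X τ + Y τ)) (Ioo 0 t) := iXY.const_mul _
    have iνD : IntegrableOn (fun τ => -ν * D τ) (Ioo 0 t) := iD.const_mul _
    have iR : IntegrableOn (fun τ => -ν * D τ + C₀ * (1 + X τ + Y τ)) (Ioo 0 t) := iνD.add iC
    have hmono : ∫ τ in Ioo 0 t, Φ τ ≤ ∫ τ in Ioo 0 t, (-ν * D τ + C₀ * (1 + X τ + Y τ)) :=
      setIntegral_mono_on iΦ iR measurableSet_Ioo fun τ hτ =>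
        hSEI τ ⟨hτ.1.le, hτ.2.le.trans ht.2⟩
    have e : ∫ τ in Ioo 0 t, (-ν * D τ + C₀ * (1 + X τ + Y τ)) =
        -ν * (∫ τ in Ioo 0 t, D τ) + C₀ * (t + (∫ τ in Ioo 0 t, X τ) + ∫ τ in Ioo 0 t, Y τ) := by
      rw [integral_add iνD iC, integral_const_mul, integral_const_mul, integral_add i1X iY,
        integral_add i1 iX, setIntegral_const, Real.volume_real_Ioo, sub_zero, max_eq_left ht.1,
        smul_eq_mul, mul_one]
    have h1 := hFTC t ht
    have h2 := hY_le t ht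
    have h3 : X 0 ≤ X₀ := by rw [hX]; exact hX₀ R hR
    have h4 : C₀ * t ≤ C₀ * T := mul_le_mul_of_nonneg_left ht.2 hC₀0
    rw [hA]
    nlinarith [mul_le_mul_of_nonneg_left h2 hC₀0]
  -- Grönwall
  have hG : ∀ t ∈ Icc 0 T, X t ≤ A * Real.exp (C₀ * t) := by
    refine le_mul_exp_of_le_add_mul_integral cX hC₀0 fun t ht => ?_
    rw [intervalIntegral.integral_of_le ht.1, integral_Ioc_eq_integral_Ioo]
    have := hmain t ht
    have hD_int : 0 ≤ ∫ τ in Ioo 0 t, D τ := setIntegral_nonneg measurableSet_Ioo fun τ _ => hD0' τ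
    nlinarith [mul_nonneg hν.le hD_int]
  have hXM : ∀ t ∈ Icc 0 T, X t ≤ M₁ := fun t ht =>
    (hG t ht).trans (mul_le_mul_of_nonneg_left (Real.exp_le_exp.2
      (mul_le_mul_of_nonneg_left ht.2 hC₀0)) hA0)
  -- the dissipation
  have hTT : T ∈ Icc 0 T := ⟨hT.le, le_rfl⟩
  have hXint : ∫ τ in Ioo 0 T, X τ ≤ T * M₁ := by
    have iX := integrableOn_Ioo_of_continuousOn cX hTT
    have i1 : IntegrableOn (fun _ => M₁) (Ioo 0 T) :=
      integrableOn_const (by rw [Real.volume_Ioo]; exact ENNReal.ofReal_ne_top)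
    calc ∫ τ in Ioo 0 T, X τ ≤ ∫ _ in Ioo 0 T, M₁ :=
          setIntegral_mono_on iX i1 measurableSet_Ioo fun τ hτ => hXM τ ⟨hτ.1.le, hτ.2.le⟩
      _ = T * M₁ := by
          rw [setIntegral_const, Real.volume_real_Ioo, sub_zero, max_eq_left hT.le, smul_eq_mul]
  have hDM : ∫ τ in Ioo 0 T, D τ ≤ (A + C₀ * (T * M₁)) / ν := by
    rw [le_div_iff₀ hν]
    have := hmain T hTT
    nlinarith [hX0' T, mul_le_mul_of_nonneg_left hXint hC₀0]
  refine ⟨fun t ht => ?_, ?_⟩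
  · have := hXM t ht
    rw [hX] at this
    exact this.trans (le_max_left _ _)
  · rw [hD] at hDM
    exact hDM.trans (le_max_right _ _)

/-- A continuous `g ≥ 0` with `∫⁻ ofReal g ≤ ofReal M`, `M ≥ 0`, is integrable with `∫ g ≤ M`.
[folklore] -/
theorem integrable_and_integral_le_of_lintegral_ofReal_le {g : EuclideanSpace ℝ (Fin 3) → ℝ} (hg : Continuous g)
    (hg0 : ∀ x, 0 ≤ g x) {M : ℝ} (hM : 0 ≤ M) (h : ∫⁻ x, ENNReal.ofReal (g x) ≤ ENNReal.ofReal M) :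
    Integrable g ∧ ∫ x, g x ≤ M := by
  have hfin : ∫⁻ x, ENNReal.ofReal (g x) < ⊤ := h.trans_lt ENNReal.ofReal_lt_top
  have hint : Integrable g := by
    refine ⟨hg.aestronglyMeasurable, (hasFiniteIntegral_iff_enorm).2 (lt_of_le_of_lt (le_of_eq ?_) hfin)⟩
    exact lintegral_congr fun x => Real.enorm_eq_ofReal (hg0 x)
  refine ⟨hint, ?_⟩
  rw [← ENNReal.ofReal_le_ofReal_iff hM, ofReal_integral_eq_lintegral_ofReal hint
    (ae_of_all _ hg0)]
  exact h

/-- `χ_Rʲ g` is integrable on `ℝ³` for continuous `g`, `R > 0`, `j ≠ 0`. [folklore] -/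
theorem integrable_cutoff_pow_mul {g : EuclideanSpace ℝ (Fin 3) → ℝ} (hg : Continuous g) {R : ℝ} (hR : 0 < R) {j : ℕ}
    (hj : j ≠ 0) : Integrable fun x => cutoff R x ^ j * g x :=
  integrable_pow_mul_of_continuous (contDiff_cutoff (E := (EuclideanSpace ℝ (Fin 3))) (n := 0) R).continuous
    (hasCompactSupport_cutoff (E := (EuclideanSpace ℝ (Fin 3))) hR) hg hj

/-- A uniform bound for the partial derivatives of the cutoffs `χ_R`, `R ≥ 1`. [folklore] -/
theorem exists_abs_pderiv_cutoff_le :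
    ∃ c : ℝ, 0 ≤ c ∧ ∀ R : ℝ, 1 ≤ R → ∀ (l : Fin 3) (x : EuclideanSpace ℝ (Fin 3)),
      |pderiv l (cutoff (E := (EuclideanSpace ℝ (Fin 3))) R) x| ≤ c := by
  obtain ⟨c, hc0, hc⟩ := exists_norm_fderiv_cutoff_le (E := (EuclideanSpace ℝ (Fin 3)))
  exact ⟨c, hc0, fun R hR l x => (abs_pderiv_le_norm_fderiv l _ x).trans
    ((hc R (by linarith) x).trans (div_le_self hc0 hR))⟩

/-- **The weighted div–curl inequality along a classical solution**: for `R ≥ 1`, `t ∈ [0, T]`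
and every `m`, `∫ χ_R⁴ |∇^{m+1}u(t)|² ≤ ∫ χ_R⁴ |∇ᵐΩ(t)|² + 48 c² ∫ χ_R² |∇ᵐu(t)|²`, with `c` a
bound for the partial derivatives of the cutoffs `χ_R`, `R ≥ 1`
(`integral_pow_four_mul_levelSq_succ_le`). [folklore] -/
theorem IsClassicalNSSolutionOn.integral_cutoff_levelSq_succ_le
    (h : IsClassicalNSSolutionOn (Icc 0 T) ν 0 u p) {c : ℝ}
    (hc : ∀ R : ℝ, 1 ≤ R → ∀ (l : Fin 3) (x : EuclideanSpace ℝ (Fin 3)), |pderiv l (cutoff (E := (EuclideanSpace ℝ (Fin 3))) R) x| ≤ c) {R : ℝ}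
    (hR : 1 ≤ R) {t : ℝ} (ht : t ∈ Icc 0 T) (m : ℕ) :
    ∫ x, cutoff R x ^ 4 * levelSq (m + 1) (u t) x ≤
      (∫ x, cutoff R x ^ 4 * vortSq m (u t) x) +
        48 * c ^ 2 * ∫ x, cutoff R x ^ 2 * levelSq m (u t) x := by
  have hR0 : 0 < R := by linarith
  have := integral_pow_four_mul_levelSq_succ_le (h.contDiff_velocity ht)
    (h.sum_pderiv_comp_eq_zero ht) (contDiff_cutoff (E := (EuclideanSpace ℝ (Fin 3))) R)
    (hasCompactSupport_cutoff (E := (EuclideanSpace ℝ (Fin 3))) hR0) (cutoff_nonneg R) (hc R hR) m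
  rw [Fintype.card_fin] at this
  push_cast at this
  linarith

/-- **Exhaustion, `sup_t` half.** If `∫ χ_R⁴ |∇ⁿΩ(t)|² ≤ M` for all `R ≥ 1` and
`∫ |∇ⁿu(t)|² ≤ Sₙ`, then `|∇^{n+1}u(t)|²` is integrable with `∫ |∇^{n+1}u(t)|² ≤ M + 48 c² Sₙ`
(the weighted div–curl inequality and monotone convergence `R → ∞`). [folklore] -/
theorem IsClassicalNSSolutionOn.integrable_levelSq_succ_of_uniform
    (h : IsClassicalNSSolutionOn (Icc 0 T) ν 0 u p) {c : ℝ}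
    (hc : ∀ R : ℝ, 1 ≤ R → ∀ (l : Fin 3) (x : EuclideanSpace ℝ (Fin 3)), |pderiv l (cutoff (E := (EuclideanSpace ℝ (Fin 3))) R) x| ≤ c) {n : ℕ} {t : ℝ}
    (ht : t ∈ Icc 0 T) {M Sn : ℝ} (hM0 : 0 ≤ M)
    (hM : ∀ R : ℝ, 1 ≤ R → ∫ x, cutoff R x ^ 4 * vortSq n (u t) x ≤ M)
    (hSi : Integrable (levelSq n (u t))) (hSle : ∫ x, levelSq n (u t) x ≤ Sn) :
    Integrable (levelSq (n + 1) (u t)) ∧ ∫ x, levelSq (n + 1) (u t) x ≤ M + 48 * c ^ 2 * Sn := by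
  have hv := h.contDiff_velocity ht
  have hSn0 : 0 ≤ Sn := (integral_nonneg (levelSq_nonneg n (u t))).trans hSle
  have hloc : ∀ R, 1 ≤ R → ∫ x, cutoff R x ^ (3 + 1) * levelSq (n + 1) (u t) x ≤
      M + 48 * c ^ 2 * Sn + 0 / R := by
    intro R hR
    have hR0 : 0 < R := by linarith
    rw [zero_div, add_zero]
    refine (h.integral_cutoff_levelSq_succ_le hc hR ht n).trans (add_le_add (hM R hR)
      (mul_le_mul_of_nonneg_left ?_ (by positivity)))
    exact (integral_pow_mul_le_integral (continuous_levelSq hv n) (levelSq_nonneg n _)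
      hSi (contDiff_cutoff (E := (EuclideanSpace ℝ (Fin 3))) R) (hasCompactSupport_cutoff (E := (EuclideanSpace ℝ (Fin 3))) hR0) (cutoff_nonneg R)
      (cutoff_le_one R) two_ne_zero).trans hSle
  have hlin := lintegral_ofReal_le_of_forall_integral_cutoff_pow_mul_le (continuous_levelSq hv _)
    (levelSq_nonneg _ _) 3 hloc
  exact integrable_and_integral_le_of_lintegral_ofReal_le (continuous_levelSq hv _)
    (levelSq_nonneg _ _) (by positivity) hlin

/-- **Exhaustion, `L²_t` half.** If `∫₀ᵀ∫ χ_R⁴ |∇^{n+1}Ω|² ≤ M` and `∫₀ᵀ∫ χ_R² |∇^{n+1}u|² ≤ I` for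
all `R ≥ 1`, then `∫₀ᵀ∫ χ_R² |∇^{n+2}u|² ≤ M + 48 c² I` for all `R ≥ 1` (`χ_R² ≤ χ_{2R}⁴` and the
weighted div–curl inequality at radius `2R`). [folklore] -/
theorem IsClassicalNSSolutionOn.integral_Ioo_cutoff_levelSq_le_of_uniform
    (h : IsClassicalNSSolutionOn (Icc 0 T) ν 0 u p) (hT : 0 < T) {c : ℝ}
    (hc : ∀ R : ℝ, 1 ≤ R → ∀ (l : Fin 3) (x : EuclideanSpace ℝ (Fin 3)), |pderiv l (cutoff (E := (EuclideanSpace ℝ (Fin 3))) R) x| ≤ c) {n : ℕ} {M I : ℝ}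
    (hM : ∀ R : ℝ, 1 ≤ R → ∫ τ in Ioo 0 T, ∫ x, cutoff R x ^ 4 * vortSq (n + 1) (u τ) x ≤ M)
    (hI : ∀ R : ℝ, 1 ≤ R → ∫ τ in Ioo 0 T, ∫ x, cutoff R x ^ 2 * levelSq (n + 1) (u τ) x ≤ I)
    {R : ℝ} (hR : 1 ≤ R) :
    ∫ τ in Ioo 0 T, ∫ x, cutoff R x ^ 2 * levelSq (n + 2) (u τ) x ≤ M + 48 * c ^ 2 * I := by
  have hR0 : 0 < R := by linarith
  have h2R : 1 ≤ 2 * R := by linarith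
  have h2R0 : 0 < 2 * R := by linarith
  have hTT : T ∈ Icc 0 T := ⟨hT.le, le_rfl⟩
  have cA := h.continuousOn_integral_cutoff_pow_mul_levelSq hT hR0 2 (n + 2) two_ne_zero
  have cA' := h.continuousOn_integral_cutoff_pow_mul_levelSq hT h2R0 4 (n + 2) (by norm_num)
  have cD := h.continuousOn_integral_cutoff_pow_mul_vortSq hT h2R0 4 (n + 1) (by norm_num)
  have cY := h.continuousOn_integral_cutoff_pow_mul_levelSq hT h2R0 2 (n + 1) two_ne_zero
  have iA := integrableOn_Ioo_of_continuousOn cA hTT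
  have iA' := integrableOn_Ioo_of_continuousOn cA' hTT
  have iD := integrableOn_Ioo_of_continuousOn cD hTT
  have iY := integrableOn_Ioo_of_continuousOn cY hTT
  have iY' : IntegrableOn (fun τ => 48 * c ^ 2 *
      ∫ x, cutoff (2 * R) x ^ 2 * levelSq (n + 1) (u τ) x) (Ioo 0 T) := iY.const_mul (48 * c ^ 2)
  have iS : IntegrableOn (fun τ => (∫ x, cutoff (2 * R) x ^ 4 * vortSq (n + 1) (u τ) x) +
      48 * c ^ 2 * ∫ x, cutoff (2 * R) x ^ 2 * levelSq (n + 1) (u τ) x) (Ioo 0 T) := iD.add iY'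
  have step1 : ∫ τ in Ioo 0 T, ∫ x, cutoff R x ^ 2 * levelSq (n + 2) (u τ) x ≤
      ∫ τ in Ioo 0 T, ∫ x, cutoff (2 * R) x ^ 4 * levelSq (n + 2) (u τ) x := by
    refine setIntegral_mono_on iA iA' measurableSet_Ioo fun τ hτ => ?_
    have hv := h.contDiff_velocity ⟨hτ.1.le, hτ.2.le⟩
    exact integral_mono (integrable_cutoff_pow_mul (continuous_levelSq hv (n + 2)) hR0 two_ne_zero)
      (integrable_cutoff_pow_mul (continuous_levelSq hv (n + 2)) h2R0 (by norm_num))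
      fun x => mul_le_mul_of_nonneg_right (cutoff_sq_le_cutoff_two_mul_pow_four hR0 x)
        (levelSq_nonneg _ _ x)
  have step2 : ∫ τ in Ioo 0 T, ∫ x, cutoff (2 * R) x ^ 4 * levelSq (n + 2) (u τ) x ≤
      ∫ τ in Ioo 0 T, ((∫ x, cutoff (2 * R) x ^ 4 * vortSq (n + 1) (u τ) x) +
        48 * c ^ 2 * ∫ x, cutoff (2 * R) x ^ 2 * levelSq (n + 1) (u τ) x) :=
    setIntegral_mono_on iA' iS measurableSet_Ioo fun τ hτ =>
      h.integral_cutoff_levelSq_succ_le hc h2R ⟨hτ.1.le, hτ.2.le⟩ (n + 1)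
  have step3 : ∫ τ in Ioo 0 T, ((∫ x, cutoff (2 * R) x ^ 4 * vortSq (n + 1) (u τ) x) +
        48 * c ^ 2 * ∫ x, cutoff (2 * R) x ^ 2 * levelSq (n + 1) (u τ) x) =
      (∫ τ in Ioo 0 T, ∫ x, cutoff (2 * R) x ^ 4 * vortSq (n + 1) (u τ) x) +
        48 * c ^ 2 * ∫ τ in Ioo 0 T, ∫ x, cutoff (2 * R) x ^ 2 * levelSq (n + 1) (u τ) x := by
    rw [integral_add iD iY', integral_const_mul]
  have hc2 : 0 ≤ 48 * c ^ 2 := by positivity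
  calc ∫ τ in Ioo 0 T, ∫ x, cutoff R x ^ 2 * levelSq (n + 2) (u τ) x
      ≤ (∫ τ in Ioo 0 T, ∫ x, cutoff (2 * R) x ^ 4 * vortSq (n + 1) (u τ) x) +
          48 * c ^ 2 * ∫ τ in Ioo 0 T, ∫ x, cutoff (2 * R) x ^ 2 * levelSq (n + 1) (u τ) x :=
        step1.trans (step2.trans_eq step3)
    _ ≤ M + 48 * c ^ 2 * I := add_le_add (hM (2 * R) h2R) (mul_le_mul_of_nonneg_left (hI (2 * R) h2R) hc2)

/-- **The induction step `X^n → X^{n+1}`.** For an unforced classical solution on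
`[0, T] × ℝ³` with `ν > 0` and `n ≥ 1`: if `sup_t ∫ |∇ᵐu(t)|² < ∞` for `m ≤ n`, the localised
`L²_t` norms of `∇^{n+1}u` are bounded uniformly in the cutoff radius, and `|∇^{n+1}u(0)|²` is
integrable, then the same holds with `n` replaced by `n + 1` (uniform bounds on the localised
vorticity energies by `uniform_enstrophy_bounds`, the weighted div–curl inequality to return from
`∇ⁿΩ` to `∇^{n+1}u`, and exhaustion `R → ∞`). [folklore] -/
theorem IsClassicalNSSolutionOn.sobolev_step
    (h : IsClassicalNSSolutionOn (Icc 0 T) ν 0 u p) (hν : 0 < ν) (hT : 0 < T) {n : ℕ}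
    (hn : 1 ≤ n) (hdat : Integrable (levelSq (n + 1) (u 0)))
    (hPS : ∀ m ≤ n, ∃ S : ℝ, ∀ t ∈ Icc 0 T,
      Integrable (levelSq m (u t)) ∧ ∫ x, levelSq m (u t) x ≤ S)
    (hPI : ∃ I : ℝ, ∀ R, 1 ≤ R →
      ∫ τ in Ioo 0 T, ∫ x, cutoff R x ^ 2 * levelSq (n + 1) (u τ) x ≤ I) :
    (∃ S : ℝ, ∀ t ∈ Icc 0 T,
        Integrable (levelSq (n + 1) (u t)) ∧ ∫ x, levelSq (n + 1) (u t) x ≤ S) ∧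
      ∃ I : ℝ, ∀ R, 1 ≤ R →
        ∫ τ in Ioo 0 T, ∫ x, cutoff R x ^ 2 * levelSq (n + 2) (u τ) x ≤ I := by
  -- uniform nonnegative constants
  choose! Sf hSf using hPS
  obtain ⟨S, hSdef⟩ : ∃ S : ℕ → ℝ, S = fun m => max (Sf m) 0 := ⟨_, rfl⟩
  have hS0 : ∀ m, 0 ≤ S m := fun m => by rw [hSdef]; exact le_max_right _ _
  have hS : ∀ m ≤ n, ∀ t ∈ Icc 0 T,
      Integrable (levelSq m (u t)) ∧ ∫ x, levelSq m (u t) x ≤ S m := fun m hm t ht =>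
    ⟨(hSf m hm t ht).1, (hSf m hm t ht).2.trans (by rw [hSdef]; exact le_max_left _ _)⟩
  obtain ⟨I, hI⟩ := hPI
  obtain ⟨c, hc0, hc⟩ := exists_abs_pderiv_cutoff_le
  have h0T : (0 : ℝ) ∈ Icc 0 T := ⟨le_rfl, hT.le⟩
  have hu0 : ContDiff ℝ ∞ (u 0) := h.contDiff_velocity h0T
  -- the initial localised vorticity energy
  have hvort0 : Integrable (vortSq n (u 0)) := by
    refine (hdat.const_mul 4).mono' (continuous_vortSq hu0 n).aestronglyMeasurable
      (Eventually.of_forall fun x => ?_)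
    rw [Real.norm_of_nonneg (vortSq_nonneg n _ x)]
    exact vortSq_le_four_mul_levelSq_succ hu0 n x
  have hX₀ : ∀ R, 1 ≤ R →
      ∫ x, cutoff R x ^ 4 * vortSq n (u 0) x ≤ 4 * ∫ x, levelSq (n + 1) (u 0) x := by
    intro R hR
    have hR0 : 0 < R := by linarith
    calc ∫ x, cutoff R x ^ 4 * vortSq n (u 0) x ≤ ∫ x, vortSq n (u 0) x :=
          integral_pow_mul_le_integral (continuous_vortSq hu0 n) (vortSq_nonneg n _) hvort0
            (contDiff_cutoff (E := (EuclideanSpace ℝ (Fin 3))) R) (hasCompactSupport_cutoff (E := (EuclideanSpace ℝ (Fin 3))) hR0)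
            (cutoff_nonneg R) (cutoff_le_one R) (by norm_num)
      _ ≤ ∫ x, 4 * levelSq (n + 1) (u 0) x :=
          integral_mono hvort0 (hdat.const_mul 4) fun x => vortSq_le_four_mul_levelSq_succ hu0 n x
      _ = 4 * ∫ x, levelSq (n + 1) (u 0) x := integral_const_mul _ _
  -- Grönwall
  obtain ⟨M, hM⟩ := h.uniform_enstrophy_bounds hν hT hn S hS0 hS hI hX₀
  have hM0 : 0 ≤ M := le_trans (integral_nonneg fun x =>
    mul_nonneg (pow_nonneg (cutoff_nonneg _ _) 4) (vortSq_nonneg _ _ _)) ((hM 1 le_rfl).1 0 h0T)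
  refine ⟨⟨M + 48 * c ^ 2 * S n, fun t ht => ?_⟩, ⟨M + 48 * c ^ 2 * I, fun R hR => ?_⟩⟩
  · exact h.integrable_levelSq_succ_of_uniform hc ht hM0 (fun R hR => (hM R hR).1 t ht)
      (hS n le_rfl t ht).1 (hS n le_rfl t ht).2
  · exact h.integral_Ioo_cutoff_levelSq_le_of_uniform hT hc (fun R' hR' => (hM R' hR').2) hI hR

/-- For smooth `v` and `R > 0`: `ofReal (∫ χ_R² |∇ᵐv|²) ≤ 3^{m+1} ∫⁻ ‖Dᵐv‖ₑ²` (`χ_R² ≤ 1` and the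
comparison `levelSq_le_pow_mul_sq_norm_iteratedFDeriv`). [folklore] -/
theorem ofReal_integral_cutoff_sq_mul_levelSq_le {v : EuclideanSpace ℝ (Fin 3) → EuclideanSpace ℝ (Fin 3)} (hv : ContDiff ℝ ∞ v) {R : ℝ}
    (hR : 0 < R) (m : ℕ) :
    ENNReal.ofReal (∫ x, cutoff R x ^ 2 * levelSq m v x) ≤
      ENNReal.ofReal (3 ^ (m + 1)) * ∫⁻ x, ‖iteratedFDeriv ℝ m v x‖ₑ ^ 2 := by
  have hi : Integrable fun x => cutoff R x ^ 2 * levelSq m v x :=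
    integrable_cutoff_pow_mul (continuous_levelSq hv m) hR two_ne_zero
  rw [ofReal_integral_eq_lintegral_ofReal hi (ae_of_all _ fun x =>
    mul_nonneg (sq_nonneg _) (levelSq_nonneg _ _ _)), lintegral_enorm_sq_eq_lintegral_ofReal,
    ← lintegral_const_mul' _ _ ENNReal.ofReal_ne_top]
  refine lintegral_mono fun x => ?_
  rw [← ENNReal.ofReal_mul (by positivity)]
  refine ENNReal.ofReal_le_ofReal ?_
  calc cutoff R x ^ 2 * levelSq m v x ≤ 1 * levelSq m v x :=
        mul_le_mul_of_nonneg_right (pow_le_one₀ (cutoff_nonneg R x) (cutoff_le_one R x))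
          (levelSq_nonneg _ _ _)
    _ ≤ 3 ^ (m + 1) * ‖iteratedFDeriv ℝ m v x‖ ^ 2 := by
        rw [one_mul]; exact levelSq_le_pow_mul_sq_norm_iteratedFDeriv hv m x

/-- **The base case, `sup_t` half**: the `L^∞_t H¹_x` part of `X¹` bounds `∫ |∇ᵐu(t)|²`, `m ≤ 1`,
uniformly on `[0, T]` (constants `3^{m+1}`). [folklore] -/
theorem IsClassicalNSSolutionOn.sobolev_base_sup
    (h : IsClassicalNSSolutionOn (Icc 0 T) ν 0 u p) (hX : FluidPDE.MemSobolevX 1 T u) {m : ℕ}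
    (hm : m ≤ 1) :
    ∃ S : ℝ, ∀ t ∈ Icc 0 T, Integrable (levelSq m (u t)) ∧ ∫ x, levelSq m (u t) x ≤ S := by
  obtain ⟨C, hC⟩ := hX.1 m hm
  refine ⟨3 ^ (m + 1) * (C : ℝ), fun t ht => ?_⟩
  have hv := h.contDiff_velocity ht
  have hfin : ∫⁻ x, ‖iteratedFDeriv ℝ m (u t) x‖ₑ ^ 2 < ⊤ := (hC t ht).trans_lt ENNReal.coe_lt_top
  obtain ⟨hint, hle⟩ := integrable_levelSq_of_lintegral_lt_top hv m hfin
  refine ⟨hint, hle.trans (mul_le_mul_of_nonneg_left ?_ (by positivity))⟩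
  have := ENNReal.toReal_mono ENNReal.coe_ne_top (hC t ht)
  simpa using this

/-- **The base case, `L²_t` half**: the `L²_t H²_x` part of `X¹` bounds `∫₀ᵀ ∫ χ_R² |∇²u|²`
uniformly in `R` (by `27 ∫₀ᵀ ∫⁻ ‖D²u‖ₑ²`). [folklore] -/
theorem IsClassicalNSSolutionOn.sobolev_base_int
    (h : IsClassicalNSSolutionOn (Icc 0 T) ν 0 u p) (hT : 0 < T) (hX : FluidPDE.MemSobolevX 1 T u)
    {R : ℝ} (hR : 1 ≤ R) :
    ∫ τ in Ioo 0 T, ∫ x, cutoff R x ^ 2 * levelSq 2 (u τ) x ≤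
      (ENNReal.ofReal (3 ^ (2 + 1)) *
        ∫⁻ t in Ioo 0 T, ∫⁻ x, ‖iteratedFDeriv ℝ 2 (u t) x‖ₑ ^ 2).toReal := by
  have hJtop : (∫⁻ t in Ioo 0 T, ∫⁻ x, ‖iteratedFDeriv ℝ 2 (u t) x‖ₑ ^ 2) < ⊤ := hX.2
  have h27J : ENNReal.ofReal (3 ^ (2 + 1)) *
      (∫⁻ t in Ioo 0 T, ∫⁻ x, ‖iteratedFDeriv ℝ 2 (u t) x‖ₑ ^ 2) ≠ ⊤ :=
    ENNReal.mul_ne_top ENNReal.ofReal_ne_top hJtop.ne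
  have hR0 : 0 < R := by linarith
  have hTT : T ∈ Icc 0 T := ⟨hT.le, le_rfl⟩
  have cY := h.continuousOn_integral_cutoff_pow_mul_levelSq hT hR0 2 2 two_ne_zero
  have iY := integrableOn_Ioo_of_continuousOn cY hTT
  have hY0 : ∀ τ, 0 ≤ ∫ x, cutoff R x ^ 2 * levelSq 2 (u τ) x := fun τ =>
    integral_nonneg fun x => mul_nonneg (sq_nonneg _) (levelSq_nonneg _ _ _)
  rw [← ENNReal.ofReal_le_iff_le_toReal h27J, ofReal_integral_eq_lintegral_ofReal iY
    (ae_of_all _ hY0), ← lintegral_const_mul' _ _ ENNReal.ofReal_ne_top]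
  refine setLIntegral_mono' measurableSet_Ioo fun τ hτ => ?_
  exact ofReal_integral_cutoff_sq_mul_levelSq_le (h.contDiff_velocity ⟨hτ.1.le, hτ.2.le⟩) hR0 2

/-- **The base case**: membership in `X¹([0, T] × ℝ³)` (`MemSobolevX 1`) gives the level-`1`
hypotheses of `sobolev_step`. [folklore] -/
theorem IsClassicalNSSolutionOn.sobolev_base
    (h : IsClassicalNSSolutionOn (Icc 0 T) ν 0 u p) (hT : 0 < T) (hX : FluidPDE.MemSobolevX 1 T u) :
    (∀ m ≤ 1, ∃ S : ℝ, ∀ t ∈ Icc 0 T,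
        Integrable (levelSq m (u t)) ∧ ∫ x, levelSq m (u t) x ≤ S) ∧
      ∃ I : ℝ, ∀ R, 1 ≤ R →
        ∫ τ in Ioo 0 T, ∫ x, cutoff R x ^ 2 * levelSq 2 (u τ) x ≤ I :=
  ⟨fun _ hm => h.sobolev_base_sup hX hm, ⟨_, fun _ hR => h.sobolev_base_int hT hX hR⟩⟩

/-- **All levels.** For an unforced classical solution on `[0, T] × ℝ³` (`ν > 0`) in
`X¹([0, T] × ℝ³)` whose datum has all `|∇ᵐu(0)|²` integrable, every level `n ≥ 1` of the
induction holds; in particular `sup_{t ∈ [0,T]} ∫ |∇ᵐ u(t)|² < ∞` for every `m`. [folklore] -/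
theorem IsClassicalNSSolutionOn.sobolev_all
    (h : IsClassicalNSSolutionOn (Icc 0 T) ν 0 u p) (hν : 0 < ν) (hT : 0 < T)
    (hX : FluidPDE.MemSobolevX 1 T u) (hdat : ∀ m, Integrable (levelSq m (u 0))) (n : ℕ) (hn : 1 ≤ n) :
    (∀ m ≤ n, ∃ S : ℝ, ∀ t ∈ Icc 0 T,
        Integrable (levelSq m (u t)) ∧ ∫ x, levelSq m (u t) x ≤ S) ∧
      ∃ I : ℝ, ∀ R, 1 ≤ R →
        ∫ τ in Ioo 0 T, ∫ x, cutoff R x ^ 2 * levelSq (n + 1) (u τ) x ≤ I := by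
  induction n, hn using Nat.le_induction with
  | base => exact h.sobolev_base hT hX
  | succ n hn ih =>
      obtain ⟨hS, hI⟩ := h.sobolev_step hν hT hn (hdat (n + 1)) ih.1 ih.2
      refine ⟨fun m hm => ?_, hI⟩
      rcases Nat.lt_or_ge m (n + 1) with hm' | hm'
      · exact ih.1 m (Nat.lt_succ_iff.1 hm')
      · have : m = n + 1 := le_antisymm hm hm'
        subst this
        exact hS

end Solution

end Literature.Analysis.FluidPDE

/-! ## Discharge of `NS.tao2011_hasBoundedSobolevNormsOn_of_memSobolevX` -/

namespace Literature.Analysis.FluidPDE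



/-- **Discharge of `tao2011_hasBoundedSobolevNormsOn_of_memSobolevX`** (Tao 2011, Cor. 4.3 +
Thm. 5.4 (iv) with the closing note of its proof, homogeneous case, classical solutions on the
closed slab): a classical solution of Navier–Stokes on `[0, T] × ℝ³` (`ν > 0`, `f = 0`) lying in
`X¹([0, T] × ℝ³)` whose datum has all derivatives in `L²` has all Sobolev norms bounded on
`[0, T]`. The printed proof goes through the mild formulation (pressure normalisation, Cor. 4.3,
and the `H¹` local well-posedness and persistence-of-regularity theory, Thm. 5.4); the proof
given here is the classical physical-space alternative for *classical* solutions — the energy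
method for the differentiated **vorticity equation** (which eliminates the pressure), localised
with smooth cutoffs `χ_R⁴` since no spatial decay of the higher derivatives is known a priori:
the slice inequality `∂ₜ X_R ≤ −ν D_R + C (1 + X_R + Y_R)` for `X_R = ∫ χ_R⁴ |∇ⁿΩ|²`
(`NSVorticitySlice`: Hölder, the Gagliardo–Nirenberg–Sobolev inequality of Mathlib and Young's
inequality for the transport and stretching terms, the weighted div–curl inequality of
Doering–Gibbon type to control `∇^{n+1}u` by `∇ⁿΩ`), Grönwall's inequality, exhaustion
`R → ∞` by monotone convergence, and induction on `n` starting from the `X¹` hypothesis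
(`sobolev_all`); the coordinate tensors `|∇ᵐu|²` are finally compared with the Fréchet
derivatives `‖Dᵐu‖²` (constants `3^{m+1}`). [cite: Tao2011, Cor. 4.3 + Thm. 5.4 (iv)] -/
theorem tao2011_hasBoundedSobolevNormsOn_of_memSobolevX_holds :
    tao2011_hasBoundedSobolevNormsOn_of_memSobolevX := by
  intro ν T hν hT u p hsol hX h₀
  have h0T : (0 : ℝ) ∈ Icc 0 T := ⟨le_rfl, hT.le⟩
  have hu0 : ContDiff ℝ ∞ (u 0) := hsol.contDiff_velocity h0T
  have hdat : ∀ m, Integrable (levelSq m (u 0)) := fun m =>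
    (integrable_levelSq_of_lintegral_lt_top hu0 m (h₀ m)).1
  intro k
  -- level `max k 1 ≥ k`
  obtain ⟨hS, -⟩ := hsol.sobolev_all hν hT hX hdat (max k 1) (le_max_right _ _)
  obtain ⟨S, hSk⟩ := hS k (le_max_left _ _)
  refine ⟨(3 ^ (k + 1) * S).toNNReal, fun t ht => ?_⟩
  have hv := hsol.contDiff_velocity ht
  refine (lintegral_sq_norm_iteratedFDeriv_le hv k (hSk t ht).1).trans ?_
  change ENNReal.ofReal _ ≤ ENNReal.ofReal _
  exact ENNReal.ofReal_le_ofReal (mul_le_mul_of_nonneg_left (hSk t ht).2 (by positivity))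

/-- **Cor. 11.1 ⇒ the route fact.** With `tao2011_hasBoundedSobolevNormsOn_of_memSobolevX` now
proved, Tao's bounded-enstrophy corollary (Cor. 11.1, `tao2011_boundedEnstrophy`) alone implies
`tao2011_hasBoundedSobolevNormsOn` (assembly `tao2011_hasBoundedSobolevNormsOn_of_parts` of
`TaoLocalisation`). [cite: Tao2011, Cor. 11.1 + Cor. 4.3 + Thm. 5.4 (iv)] -/
theorem tao2011_hasBoundedSobolevNormsOn_of_boundedEnstrophy (hA : tao2011_boundedEnstrophy) :
    tao2011_hasBoundedSobolevNormsOn :=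
  tao2011_hasBoundedSobolevNormsOn_of_parts hA tao2011_hasBoundedSobolevNormsOn_of_memSobolevX_holds

/-- **Thm. 10.1 (exterior form) ⇒ the route fact.** Of the three leaves of the decomposition
of `tao2011_hasBoundedSobolevNormsOn` (`TaoEnstrophyLocalisation`:
`tao2011_hasBoundedSobolevNormsOn_of_parts'`), two are now theorems
(`tao2011_sobolev_of_vorticity_holds`, `TaoEnstrophyLocalisationProofs`;
`tao2011_hasBoundedSobolevNormsOn_of_memSobolevX_holds`, this file), so the route fact follows
from the enstrophy localisation estimate `tao2011_enstrophyLocalisation_exterior` (Tao 2011,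
Thm. 10.1 with Remark 10.6) alone. [cite: Tao2011, Thm. 10.1 + Cor. 11.1 + Cor. 4.3 + Thm. 5.4 (iv)] -/
theorem tao2011_hasBoundedSobolevNormsOn_of_enstrophyLocalisation
    (hA : tao2011_enstrophyLocalisation_exterior) : tao2011_hasBoundedSobolevNormsOn :=
  tao2011_hasBoundedSobolevNormsOn_of_parts' hA tao2011_sobolev_of_vorticity_holds
    tao2011_hasBoundedSobolevNormsOn_of_memSobolevX_holds

/-- **The route fact from the printed leaves of Thm. 10.1.** Combining the previous corollary
with the decomposition of Thm. 10.1 along its printed proof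
(`TaoEnstrophyLocalisationParts`: Lemma 8.1 `tao_finite_energy_smooth_energy_bound`, Prop. 9.1
`tao2011_boundedTotalSpeed`, and the a priori form of the §10 argument
`tao2011_enstrophyLocalisation_exterior_apriori`), `tao2011_hasBoundedSobolevNormsOn` follows
from these three named facts alone — the `B`-side hypotheses of
`tao2011_hasBoundedSobolevNormsOn_of_leaves` are no longer needed. [cite: Tao2011, Lemma 8.1 + Prop. 9.1 + Thm. 10.1 + Cor. 11.1 + Cor. 4.3 + Thm. 5.4 (iv)] -/
theorem tao2011_hasBoundedSobolevNormsOn_of_apriori_leaves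
    (hL : tao_finite_energy_smooth_energy_bound) (hP : tao2011_boundedTotalSpeed)
    (hA' : tao2011_enstrophyLocalisation_exterior_apriori) : tao2011_hasBoundedSobolevNormsOn :=
  tao2011_hasBoundedSobolevNormsOn_of_enstrophyLocalisation
    (tao2011_enstrophyLocalisation_exterior_of_parts hL hP hA')

end Literature.Analysis.FluidPDE

end
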